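import Literature.Analysis.Quadrature.KernelDyadicEnclosures
import Literature.Analysis.Quadrature.CosineHatMajorant
import Literature.MathematicalPhysics.QuantumLattice.HubbardThermalDoccFreeEntropyChord
import Mathlib.Analysis.Real.Pi.Bounds
import HarnessLib

/-!
# Kernel-checked quadrature for the free-fermion grand-canonical pressure `P₀(β, μ)` of the square lattice

Topic `MathematicalPhysics/QuantumLattice` (family `hubbard`; hubbard-tc cell, MO-S3 `T_c` back-end, seat mod-2, 2026-08-27).
`freeGCPressure β μ = (2π)⁻² ∫_{[-π,π]²} 2 log(1 + e^{β(μ - 2cos k₀ - 2cos k₁)}) dk` (`HubbardThermalDoccFreeEntropyChord`) is the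
free end of the Peierls–Bogoliubov double-occupancy chord behind every K3-free KT row of the cell; its values entered the tree as
`@[conjecture]` claim nodes `cert_freeGC_quad_*` (two-engine + interval replays). This file makes such ceilings KERNEL theorems:

* §1 the node family `u_p = ∓(N² - j²)/(N² + j²)` (`j = p` resp. `2N - p`; `cos`/`sin` of `π - 2·arctan(j/N)` resp. `2·arctan(j/N)`
  are RATIONAL), its angles, and certified enclosures `RLo ≤ R(u_p) ≤ RHi`, `Ω_p ≤ omegaPlus N p` of the hat integrals of
  `CosineHatMajorant` (via the `2·arctan` tables and the 20-digit `π` brackets of Mathlib);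
* §2 the integrand `g(a,b) = 2 log(1 + e^{β(μ-2a-2b)})` (convex in each variable), the table `Entry` (index, `Ω⁺`, enclosure of
  `e^{-2βu_p}`) and `gBound ≥ g(u_p, u_q)` from `expEncl` / `log1pUpper` of `KernelDyadicEnclosures`;
* §3 the Boolean `check` and **`freeGCPressure_le_of_check`**: `check β μ N emu L P = true → freeGCPressure β μ ≤ P`.

One `decide +kernel` per node then discharges a claim (`Summits/…/Certificates/HubbardSquare_freeGCPressure_quadrature.lean`); at
`N = 32` (65 × 65 nodes) the second-order slack is `≈ 9·10⁻⁴` on `P₀ ≈ 4.6`, ≈ 50 s of kernel time.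

Everything is PROVED (standard axioms). HONEST FRAMING: one-body numerics (an upper bound on an explicit integral); nothing here is a
statement about the Hubbard model beyond the free gas.

References: Davis–Rabinowitz §2.1 / §5.6 (one-sided trapezoid for convex integrands; product rules) [cite: DavisRabinowitz1984, Sect. 2.1];
Abramowitz–Stegun 4.4.34 / 4.4.42 / 4.2.1 / 4.1.24 [cite: AbramowitzStegun1964, 4.4.34]; Ashcroft–Mermin Ch. 2 (2.49) (the free
grand potential) [cite: AshcroftMermin1976, Ch. 2 eq. (2.49)].
-/

noncomputable section

namespace Literature.MathematicalPhysics.QuantumLattice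

namespace FreeGCQuadrature

open Real Set MeasureTheory Finset Literature.Probability.LatticeModels
open Literature.Analysis.Quadrature.KernelQuadrature
open scoped BigOperators

/-! ### §1 Nodes, angles and the certified hat integrals -/

/-- `3.14159265358979323846 < π` (`Real.pi_gt_d20`). [folklore] -/
def piLo : ℚ := 314159265358979323846 / 100000000000000000000
/-- `π < 3.14159265358979323847` (`Real.pi_lt_d20`). [folklore] -/
def piHi : ℚ := 314159265358979323847 / 100000000000000000000

/-- `c_j = (N² - j²)/(N² + j²) = cos (2·arctan (j/N))`. [cite: AbramowitzStegun1964, 4.4.34] -/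
def cOf (N j : ℕ) : ℚ := ((N : ℚ) * N - (j : ℚ) * j) / ((N : ℚ) * N + (j : ℚ) * j)
/-- `s_j = 2jN/(N² + j²) = sin (2·arctan (j/N))`. [cite: AbramowitzStegun1964, 4.4.34] -/
def sOf (N j : ℕ) : ℚ := 2 * (j : ℚ) * N / ((N : ℚ) * N + (j : ℚ) * j)
/-- The table parameter `j(p)`: `p` for `p ≤ N`, `2N - p` beyond. [folklore] -/
def nodeJ (N p : ℕ) : ℕ := if p ≤ N then p else 2 * N - p
/-- The nodes `u_0 = -1 < … < u_N = 0 < … < u_{2N} = 1`: `-c_p` (`p ≤ N`), `c_{2N-p}` (`p > N`). [cite: DavisRabinowitz1984, Sect. 2.1] -/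
def nodeU (N p : ℕ) : ℚ := if p ≤ N then -cOf N p else cOf N (2 * N - p)
/-- `sin θ_p` (rational). [cite: AbramowitzStegun1964, 4.4.34] -/
def nodeSin (N p : ℕ) : ℚ := sOf N (nodeJ N p)
/-- Lower enclosure of `θ_p = arccos u_p` (`π - 2·arctan(p/N)` resp. `2·arctan((2N-p)/N)`). [cite: AbramowitzStegun1964, 4.4.42] -/
def thetaLo (N p : ℕ) : ℚ := if p ≤ N then piLo - atanHi N p else atanLo N (2 * N - p)
/-- Upper enclosure of `θ_p`. [cite: AbramowitzStegun1964, 4.4.42] -/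
def thetaHi (N p : ℕ) : ℚ := if p ≤ N then piHi - atanLo N p else atanHi N (2 * N - p)
/-- Lower enclosure of `R(u_p) = 2(sin θ_p - u_p θ_p)`. [cite: DavisRabinowitz1984, Sect. 2.1] -/
def RLo (N p : ℕ) : ℚ :=
  if 0 ≤ nodeU N p then 2 * (nodeSin N p - nodeU N p * thetaHi N p) else 2 * (nodeSin N p - nodeU N p * thetaLo N p)
/-- Upper enclosure of `R(u_p)`. [cite: DavisRabinowitz1984, Sect. 2.1] -/
def RHi (N p : ℕ) : ℚ :=
  if 0 ≤ nodeU N p then 2 * (nodeSin N p - nodeU N p * thetaLo N p) else 2 * (nodeSin N p - nodeU N p * thetaHi N p)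
/-- **Certified upper bound on the hat integral `Ω_p = ∫_{-π}^{π} hat_p(cos x) dx`** (`0 ≤ p ≤ 2N`).
[cite: DavisRabinowitz1984, Sect. 2.1] -/
def omegaPlus (N p : ℕ) : ℚ :=
  if p = 0 then
    rup (((if 0 ≤ nodeU N 1 then 2 * piHi * nodeU N 1 else 2 * piLo * nodeU N 1) + RHi N 1) / (nodeU N 1 - nodeU N 0))
  else if p = 2 * N then
    rup (RHi N (2 * N - 1) / (nodeU N (2 * N) - nodeU N (2 * N - 1)))
  else
    rup ((RHi N (p - 1) - RLo N p) / (nodeU N p - nodeU N (p - 1)) - (RLo N p - RHi N (p + 1)) / (nodeU N (p + 1) - nodeU N p))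

/-- The nodes as a real family. [folklore] -/
def uR (N : ℕ) (p : ℕ) : ℝ := ((nodeU N p : ℚ) : ℝ)

/-- The angle `θ_p` with `cos θ_p = u_p`. [folklore] -/
def thetaR (N p : ℕ) : ℝ :=
  if p ≤ N then π - 2 * arctan ((p : ℝ) / N) else 2 * arctan (((2 * N - p : ℕ) : ℝ) / N)

section Nodes

variable {N : ℕ} (hN : 1 ≤ N)
include hN

omit hN in
/-- `cos (2 arctan s)` and `sin (2 arctan s)` are rational in `s`. [cite: AbramowitzStegun1964, 4.4.34] -/
private theorem cos_sin_two_arctan (s : ℝ) :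
    Real.cos (2 * arctan s) = (1 - s ^ 2) / (1 + s ^ 2) ∧ Real.sin (2 * arctan s) = 2 * s / (1 + s ^ 2) := by
  have h1 : 0 < 1 + s ^ 2 := by positivity
  have hsq : Real.sqrt (1 + s ^ 2) ^ 2 = 1 + s ^ 2 := Real.sq_sqrt h1.le
  have hsqpos : 0 < Real.sqrt (1 + s ^ 2) := Real.sqrt_pos.2 h1
  constructor
  · rw [Real.cos_two_mul, Real.cos_arctan]
    field_simp
    rw [hsq]
    ring
  · rw [Real.sin_two_mul, Real.sin_arctan, Real.cos_arctan]
    field_simp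
    rw [hsq]

/-- `c_j`, `s_j` are `cos`, `sin` of `2·arctan (j/N)`. [cite: AbramowitzStegun1964, 4.4.34] -/
private theorem cOf_sOf_eq (j : ℕ) :
    ((cOf N j : ℚ) : ℝ) = Real.cos (2 * arctan ((j : ℝ) / N)) ∧ ((sOf N j : ℚ) : ℝ) = Real.sin (2 * arctan ((j : ℝ) / N)) := by
  have hNpos : (0 : ℝ) < N := by exact_mod_cast Nat.lt_of_lt_of_le Nat.zero_lt_one hN
  have hN0 : (N : ℝ) ≠ 0 := hNpos.ne'
  obtain ⟨hc, hs⟩ := cos_sin_two_arctan ((j : ℝ) / N)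
  have hden : (0 : ℝ) < (N : ℝ) * N + (j : ℝ) * j := by positivity
  rw [hc, hs]
  constructor
  · simp only [cOf]; push_cast
    field_simp
  · simp only [sOf]; push_cast
    field_simp

/-- `cos θ_p = u_p`, `sin θ_p = nodeSin`, `0 ≤ θ_p ≤ π` (`p ≤ 2N`). [cite: AbramowitzStegun1964, 4.4.34] -/
theorem thetaR_spec (p : ℕ) (hp : p ≤ 2 * N) :
    Real.cos (thetaR N p) = uR N p ∧ Real.sin (thetaR N p) = ((nodeSin N p : ℚ) : ℝ) ∧
      0 ≤ thetaR N p ∧ thetaR N p ≤ π := by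
  have hNpos : (0 : ℝ) < N := by exact_mod_cast Nat.lt_of_lt_of_le Nat.zero_lt_one hN
  have harc : ∀ j : ℕ, j ≤ N → 0 ≤ arctan ((j : ℝ) / N) ∧ arctan ((j : ℝ) / N) ≤ π / 4 := by
    intro j hj
    refine ⟨Real.arctan_nonneg.2 (by positivity), ?_⟩
    rw [← Real.arctan_one]
    exact Real.arctan_le_arctan_iff.2 ((div_le_one hNpos).2 (by exact_mod_cast hj))
  unfold thetaR uR nodeU nodeSin nodeJ
  by_cases hpN : p ≤ N
  · simp only [if_pos hpN]
    obtain ⟨hc, hs⟩ := cOf_sOf_eq hN p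
    obtain ⟨h0, h4⟩ := harc p hpN
    refine ⟨?_, ?_, by linarith, by linarith⟩
    · rw [Real.cos_pi_sub]; push_cast; rw [hc]
    · rw [Real.sin_pi_sub, hs]
  · simp only [if_neg hpN]
    obtain ⟨hc, hs⟩ := cOf_sOf_eq hN (2 * N - p)
    obtain ⟨h0, h4⟩ := harc (2 * N - p) (by omega)
    have hpi := Real.pi_pos
    refine ⟨by rw [hc], by rw [hs], by linarith, by linarith⟩

/-- `thetaLo ≤ θ_p ≤ thetaHi`. [cite: AbramowitzStegun1964, 4.4.42] -/
theorem thetaLo_le_thetaR_le_thetaHi (p : ℕ) (hp : p ≤ 2 * N) :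
    ((thetaLo N p : ℚ) : ℝ) ≤ thetaR N p ∧ thetaR N p ≤ ((thetaHi N p : ℚ) : ℝ) := by
  have hπ1 := Real.pi_gt_d20
  have hπ2 := Real.pi_lt_d20
  unfold thetaLo thetaHi thetaR
  by_cases hpN : p ≤ N
  · simp only [if_pos hpN]
    obtain ⟨h1, h2⟩ := atanLo_le_and_le_atanHi N hN p hpN
    push_cast [piLo, piHi]
    constructor <;> linarith
  · simp only [if_neg hpN]
    obtain ⟨h1, h2⟩ := atanLo_le_and_le_atanHi N hN (2 * N - p) (by omega)
    exact ⟨h1, h2⟩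

/-- `R(u_p) = 2 (sin θ_p - u_p θ_p)` and its enclosure `RLo ≤ R(u_p) ≤ RHi`. [cite: DavisRabinowitz1984, Sect. 2.1] -/
theorem RLo_le_and_le_RHi (p : ℕ) (hp : p ≤ 2 * N) :
    ((RLo N p : ℚ) : ℝ) ≤ reluCosInt (uR N p) ∧ reluCosInt (uR N p) ≤ ((RHi N p : ℚ) : ℝ) := by
  obtain ⟨hc, hs, h0, hπ⟩ := thetaR_spec hN p hp
  obtain ⟨hl, hh⟩ := thetaLo_le_thetaR_le_thetaHi hN p hp
  have hR : reluCosInt (uR N p) = 2 * (((nodeSin N p : ℚ) : ℝ) - uR N p * thetaR N p) := by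
    rw [reluCosInt, ← hc, integral_relu_cos_sub_cos h0 hπ, hs]
    ring
  rw [hR]
  unfold RLo RHi
  by_cases hu : 0 ≤ nodeU N p
  · simp only [if_pos hu]
    have hu' : 0 ≤ uR N p := by unfold uR; exact_mod_cast hu
    push_cast
    unfold uR at hu' ⊢
    constructor <;> nlinarith [mul_le_mul_of_nonneg_left hl hu', mul_le_mul_of_nonneg_left hh hu']
  · simp only [if_neg hu]
    have hu' : uR N p ≤ 0 := by unfold uR; exact_mod_cast (lt_of_not_ge hu).le
    push_cast
    unfold uR at hu' ⊢
    constructor <;> nlinarith [mul_le_mul_of_nonpos_left hl hu', mul_le_mul_of_nonpos_left hh hu']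

/-- `c_j` is strictly decreasing in `j`. [folklore] -/
private theorem cOf_lt_cOf {j j' : ℕ} (hjj : j < j') : cOf N j' < cOf N j := by
  have hNpos : (0 : ℚ) < N := by exact_mod_cast Nat.lt_of_lt_of_le Nat.zero_lt_one hN
  have hj : (j : ℚ) < j' := by exact_mod_cast hjj
  have hj0 : (0 : ℚ) ≤ j := by positivity
  have hsq : (j : ℚ) * j < (j' : ℚ) * j' := mul_self_lt_mul_self hj0 hj
  unfold cOf
  rw [div_lt_div_iff₀ (by positivity) (by positivity)]
  nlinarith [mul_lt_mul_of_pos_left hsq (mul_pos hNpos hNpos)]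

/-- The nodes increase strictly: `u_p < u_{p+1}` for `p < 2N`. [cite: DavisRabinowitz1984, Sect. 2.1] -/
theorem uR_lt_succ (p : ℕ) (hp : p < 2 * N) : uR N p < uR N (p + 1) := by
  unfold uR
  have h : nodeU N p < nodeU N (p + 1) := by
    unfold nodeU
    by_cases h1 : p + 1 ≤ N
    · rw [if_pos (Nat.le_of_succ_le h1), if_pos h1]
      exact neg_lt_neg (cOf_lt_cOf hN (Nat.lt_succ_self p))
    · by_cases h2 : p ≤ N
      · -- `p = N`
        have hpN : p = N := le_antisymm h2 (by omega)
        rw [if_pos h2, if_neg h1, hpN]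
        have hc0 : cOf N N = 0 := by unfold cOf; simp
        rw [hc0, neg_zero]
        have hNN : 2 * N - (N + 1) = N - 1 := by omega
        rw [hNN]
        have := cOf_lt_cOf hN (show N - 1 < N by omega)
        rwa [hc0] at this
      · rw [if_neg h2, if_neg h1]
        exact cOf_lt_cOf hN (by omega)
  exact_mod_cast h

/-- `u_0 = -1`, `u_{2N} = 1`. [cite: DavisRabinowitz1984, Sect. 2.1] -/
theorem uR_zero_and_last : uR N 0 = -1 ∧ uR N (2 * N) = 1 := by
  have hNpos : (0 : ℚ) < N := by exact_mod_cast Nat.lt_of_lt_of_le Nat.zero_lt_one hN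
  have hc0 : cOf N 0 = 1 := by
    unfold cOf
    rw [Nat.cast_zero, mul_zero, sub_zero, add_zero]
    exact div_self (mul_pos hNpos hNpos).ne'
  unfold uR nodeU
  constructor
  · rw [if_pos (Nat.zero_le _), hc0]; push_cast; ring
  · have h : ¬ (2 * N ≤ N) := by omega
    rw [if_neg h, show 2 * N - 2 * N = 0 by omega, hc0]; push_cast; ring

/-- The hat integral of node `p`. [cite: DavisRabinowitz1984, Sect. 2.1] -/
def omegaR (N p : ℕ) : ℝ := ∫ x in -π..π, hat (uR N) (2 * N) p (Real.cos x)

omit hN in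
/-- `0 ≤ Ω_p`. [cite: DavisRabinowitz1984, Sect. 2.1] -/
theorem omegaR_nonneg (p : ℕ) : 0 ≤ omegaR N p :=
  intervalIntegral.integral_nonneg (by linarith [Real.pi_pos]) fun x _ => hat_nonneg _ _ _ _

/-- **`Ω_p ≤ omegaPlus N p`** for `p ≤ 2N`. [cite: DavisRabinowitz1984, Sect. 2.1] -/
theorem omegaR_le_omegaPlus (p : ℕ) (hp : p ≤ 2 * N) : omegaR N p ≤ ((omegaPlus N p : ℚ) : ℝ) := by
  have hπ1 := Real.pi_gt_d20
  have hπ2 := Real.pi_lt_d20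
  unfold omegaR omegaPlus
  by_cases hp0 : p = 0
  · subst hp0
    rw [if_pos rfl]
    have hstep := uR_lt_succ hN 0 (by omega)
    rw [integral_hat_cos_zero hstep]
    apply cast_le_rup
    have hΔ : 0 < uR N 1 - uR N 0 := sub_pos.2 hstep
    obtain ⟨_, hR1⟩ := RLo_le_and_le_RHi hN 1 (by omega)
    unfold uR at hΔ hR1 ⊢
    push_cast
    refine div_le_div_of_nonneg_right ?_ hΔ.le
    by_cases hu : 0 ≤ nodeU N 1
    · rw [if_pos hu]; push_cast [piHi]
      have hu' : (0 : ℝ) ≤ nodeU N 1 := by exact_mod_cast hu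
      nlinarith [mul_le_mul_of_nonneg_left hπ2.le hu']
    · rw [if_neg hu]; push_cast [piLo]
      have hu' : ((nodeU N 1 : ℚ) : ℝ) ≤ 0 := by exact_mod_cast (lt_of_not_ge hu).le
      nlinarith [mul_le_mul_of_nonpos_left hπ1.le hu']
  · rw [if_neg hp0]
    by_cases hpM : p = 2 * N
    · rw [if_pos hpM]
      subst hpM
      have h2N : 2 * N ≠ 0 := by omega
      have hstep := uR_lt_succ hN (2 * N - 1) (by omega)
      rw [show 2 * N - 1 + 1 = 2 * N by omega] at hstep
      rw [integral_hat_cos_last h2N hstep]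
      apply cast_le_rup
      have hΔ : 0 < uR N (2 * N) - uR N (2 * N - 1) := sub_pos.2 hstep
      obtain ⟨_, hR⟩ := RLo_le_and_le_RHi hN (2 * N - 1) (by omega)
      unfold uR at hΔ hR ⊢
      push_cast
      exact div_le_div_of_nonneg_right hR hΔ.le
    · rw [if_neg hpM]
      have hp1 : 1 ≤ p := Nat.one_le_iff_ne_zero.2 hp0
      have hs1 := uR_lt_succ hN (p - 1) (by omega)
      rw [Nat.sub_add_cancel hp1] at hs1
      have hs2 := uR_lt_succ hN p (by omega)
      rw [integral_hat_cos_interior hp0 hpM hs1 hs2]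
      apply cast_le_rup
      have hΔ1 : 0 < uR N p - uR N (p - 1) := sub_pos.2 hs1
      have hΔ2 : 0 < uR N (p + 1) - uR N p := sub_pos.2 hs2
      obtain ⟨_, hRa⟩ := RLo_le_and_le_RHi hN (p - 1) (by omega)
      obtain ⟨hRb, _⟩ := RLo_le_and_le_RHi hN p hp
      obtain ⟨_, hRc⟩ := RLo_le_and_le_RHi hN (p + 1) (by omega)
      unfold uR at hΔ1 hΔ2 hRa hRb hRc ⊢
      push_cast
      have h1 : (reluCosInt ↑(nodeU N (p - 1)) - reluCosInt ↑(nodeU N p)) / (↑(nodeU N p) - ↑(nodeU N (p - 1))) ≤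
          (((RHi N (p - 1) : ℚ) : ℝ) - RLo N p) / (↑(nodeU N p) - ↑(nodeU N (p - 1))) :=
        div_le_div_of_nonneg_right (by linarith) hΔ1.le
      have h2 : (((RLo N p : ℚ) : ℝ) - RHi N (p + 1)) / (↑(nodeU N (p + 1)) - ↑(nodeU N p)) ≤
          (reluCosInt ↑(nodeU N p) - reluCosInt ↑(nodeU N (p + 1))) / (↑(nodeU N (p + 1)) - ↑(nodeU N p)) :=
        div_le_div_of_nonneg_right (by linarith) hΔ2.le
      linarith

end Nodes

/-! ### §2 The integrand, the table and `gBound` -/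

/-- The free log-weight as a function of the two cosines: `g(a,b) = 2 log(1 + e^{β(μ - 2a - 2b)})`.
[cite: AshcroftMermin1976, Ch. 2 eq. (2.49)] -/
def gR (β μ : ℚ) (a b : ℝ) : ℝ := 2 * Real.log (1 + Real.exp ((β : ℝ) * (μ - 2 * a - 2 * b)))

/-- `w ↦ 2 log(1 + eʷ)` is convex (its derivative `2eʷ/(1+eʷ)` is monotone). [cite: HardyLittlewoodPolya1952, §3.5] -/
theorem convexOn_two_mul_log_one_add_exp : ConvexOn ℝ univ fun w : ℝ => 2 * Real.log (1 + Real.exp w) := by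
  have hd : ∀ w : ℝ, HasDerivAt (fun w : ℝ => 2 * Real.log (1 + Real.exp w)) (2 * (Real.exp w / (1 + Real.exp w))) w := by
    intro w
    have h0 : HasDerivAt (fun w => 1 + Real.exp w) (Real.exp w) w := by
      simpa using (Real.hasDerivAt_exp w).const_add 1
    exact (h0.log (by positivity)).const_mul 2
  have hderiv : deriv (fun w : ℝ => 2 * Real.log (1 + Real.exp w)) = fun w => 2 * (Real.exp w / (1 + Real.exp w)) :=
    funext fun w => (hd w).deriv
  refine MonotoneOn.convexOn_of_deriv convex_univ (fun w _ => (hd w).continuousAt.continuousWithinAt)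
    (fun w _ => (hd w).differentiableAt.differentiableWithinAt) ?_
  rw [hderiv]
  intro a _ b _ hab
  have ha := Real.exp_pos a
  have hb := Real.exp_pos b
  have hexp := Real.exp_le_exp.2 hab
  have : Real.exp a / (1 + Real.exp a) ≤ Real.exp b / (1 + Real.exp b) := by
    rw [div_le_div_iff₀ (by positivity) (by positivity)]
    nlinarith
  linarith

/-- `g ≥ 0`, continuous, convex in each cosine. [cite: HardyLittlewoodPolya1952, §3.5] -/
theorem gR_props (β μ : ℚ) :
    (∀ a b, 0 ≤ gR β μ a b) ∧ (Continuous fun ab : ℝ × ℝ => gR β μ ab.1 ab.2) ∧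
      (∀ b, ConvexOn ℝ (Icc (-1 : ℝ) 1) (fun a => gR β μ a b)) ∧ (∀ a, ConvexOn ℝ (Icc (-1 : ℝ) 1) (gR β μ a)) := by
  have hconv := convexOn_two_mul_log_one_add_exp
  have haff : ∀ c d : ℝ, ConvexOn ℝ (Icc (-1 : ℝ) 1) (fun x : ℝ => 2 * Real.log (1 + Real.exp (c * x + d))) := by
    intro c d
    refine ConvexOn.subset ?_ (subset_univ _) (convex_Icc _ _)
    refine ⟨convex_univ, fun x _ y _ p q hp hq hpq => ?_⟩
    have h := hconv.2 (mem_univ (c * x + d)) (mem_univ (c * y + d)) hp hq hpq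
    have e : p • (c * x + d) + q • (c * y + d) = c * (p • x + q • y) + d := by
      simp only [smul_eq_mul]
      rw [show q = 1 - p by linarith]
      ring
    rw [e] at h
    exact h
  refine ⟨fun a b => ?_, ?_, fun b => ?_, fun a => ?_⟩
  · unfold gR
    exact mul_nonneg zero_le_two (Real.log_nonneg (by linarith [Real.exp_pos ((β : ℝ) * (μ - 2 * a - 2 * b))]))
  · unfold gR
    have hlin : Continuous fun ab : ℝ × ℝ => (β : ℝ) * (μ - 2 * ab.1 - 2 * ab.2) := by continuity
    have hpos : ∀ ab : ℝ × ℝ, 1 + Real.exp ((β : ℝ) * (μ - 2 * ab.1 - 2 * ab.2)) ≠ 0 := fun ab => by positivity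
    exact continuous_const.mul ((continuous_const.add (Real.continuous_exp.comp hlin)).log hpos)
  · have h := haff (-2 * β) ((β : ℝ) * (μ - 2 * b))
    refine h.congr fun a _ => ?_
    unfold gR; ring_nf
  · have h := haff (-2 * β) ((β : ℝ) * (μ - 2 * a))
    refine h.congr fun b _ => ?_
    unfold gR; ring_nf

/-- One table row: node index, certified `Ω⁺ ≥ Ω_idx`, enclosure `elo ≤ e^{-2β u_idx} ≤ ehi` (the data of a product rule with
certified weights). [cite: DavisRabinowitz1984, Sect. 2.1] -/
structure Entry where
  /-- node index `p` -/
  idx : ℕ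
  /-- upper bound of the hat integral `Ω_p` -/
  om : ℚ
  /-- lower bound of `exp (-2 β u_p)` -/
  elo : ℚ
  /-- upper bound of `exp (-2 β u_p)` -/
  ehi : ℚ

/-- `0.6931471808 ≥ log 2` re-exported for the fallback branch. [folklore] -/
private theorem log_two_le_log2Hi : Real.log 2 ≤ ((log2Hi : ℚ) : ℝ) := by
  have h := Real.log_two_lt_d9
  push_cast [log2Hi]
  norm_num at h ⊢
  linarith

/-- **The table bound `G_pq`** on `g(u_p, u_q) = 2 log (1 + eʷ)`, `w = β(μ - 2u_p - 2u_q)`: for `w ≤ 0` through the product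
of the three upper exp-enclosures; for `w > 0` as `w + log(1 + e^{-w})` through the lower ones (fallback `log 2`).
[cite: AbramowitzStegun1964, 4.1.24] -/
def gBound (β μ : ℚ) (N : ℕ) (emu : ℚ × ℚ) (e f : Entry) : ℚ :=
  if β * (μ - 2 * nodeU N e.idx - 2 * nodeU N f.idx) ≤ 0 then
    rup (2 * log1pUpper (rup (rup (emu.2 * e.ehi) * f.ehi)))
  else
    rup (2 * (β * (μ - 2 * nodeU N e.idx - 2 * nodeU N f.idx) +
      (if 0 < rdn (rdn (emu.1 * e.elo) * f.elo) then log1pUpper (rup (1 / rdn (rdn (emu.1 * e.elo) * f.elo)))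
       else log2Hi)))

/-- Validity of the exponential data of an entry / of `emu`: `0 < lo ≤ eˣ ≤ hi`. [cite: AbramowitzStegun1964, 4.2.1] -/
def ExpOK (x : ℝ) (lo hi : ℚ) : Prop := 0 < ((lo : ℚ) : ℝ) ∧ ((lo : ℚ) : ℝ) ≤ Real.exp x ∧ Real.exp x ≤ ((hi : ℚ) : ℝ)

/-- **Soundness of `gBound`**: valid enclosures ⟹ `g(u_p, u_q) ≤ gBound`. [cite: AbramowitzStegun1964, 4.1.24] -/
theorem gR_le_gBound (β μ : ℚ) (N : ℕ) (emu : ℚ × ℚ) (e f : Entry)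
    (hmu : ExpOK ((β : ℝ) * μ) emu.1 emu.2)
    (he : ExpOK (-2 * (β : ℝ) * uR N e.idx) e.elo e.ehi) (hf : ExpOK (-2 * (β : ℝ) * uR N f.idx) f.elo f.ehi) :
    gR β μ (uR N e.idx) (uR N f.idx) ≤ ((gBound β μ N emu e f : ℚ) : ℝ) := by
  obtain ⟨hmu0, hmu1, hmu2⟩ := hmu
  obtain ⟨he0, he1, he2⟩ := he
  obtain ⟨hf0, hf1, hf2⟩ := hf
  set wq : ℚ := β * (μ - 2 * nodeU N e.idx - 2 * nodeU N f.idx) with hwq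
  have hw : ((wq : ℚ) : ℝ) = (β : ℝ) * (μ - 2 * uR N e.idx - 2 * uR N f.idx) := by
    rw [hwq]; unfold uR; push_cast; ring
  have hfac : Real.exp ((β : ℝ) * (μ - 2 * uR N e.idx - 2 * uR N f.idx)) =
      Real.exp ((β : ℝ) * μ) * Real.exp (-2 * (β : ℝ) * uR N e.idx) * Real.exp (-2 * (β : ℝ) * uR N f.idx) := by
    rw [← Real.exp_add, ← Real.exp_add]; ring_nf
  have hgdef : gR β μ (uR N e.idx) (uR N f.idx) = 2 * Real.log (1 + Real.exp ((wq : ℚ) : ℝ)) := by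
    unfold gR; rw [hw]
  rw [hgdef]
  unfold gBound
  rw [← hwq]
  by_cases hw0 : wq ≤ 0
  · rw [if_pos hw0]
    apply cast_le_rup
    push_cast
    have hE : Real.exp ((wq : ℚ) : ℝ) ≤ ((rup (rup (emu.2 * e.ehi) * f.ehi) : ℚ) : ℝ) := by
      apply cast_le_rup; push_cast
      rw [hw, hfac]
      have h1 : Real.exp ((β : ℝ) * μ) * Real.exp (-2 * (β : ℝ) * uR N e.idx) ≤ ((rup (emu.2 * e.ehi) : ℚ) : ℝ) := by
        apply cast_le_rup; push_cast
        exact mul_le_mul hmu2 he2 (Real.exp_pos _).le ((Real.exp_pos _).le.trans hmu2)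
      exact mul_le_mul h1 hf2 (Real.exp_pos _).le
        ((mul_pos (Real.exp_pos _) (Real.exp_pos _)).le.trans h1)
    have hle1 : Real.exp ((wq : ℚ) : ℝ) ≤ 1 := Real.exp_le_one_iff.2 (by exact_mod_cast hw0)
    have h := log_one_add_le_log1pUpper (Real.exp_pos _).le hle1 hE
    linarith
  · rw [if_neg hw0]
    apply cast_le_rup
    push_cast
    have hwpos : 0 < ((wq : ℚ) : ℝ) := by exact_mod_cast lt_of_not_ge hw0
    -- `log(1 + eʷ) = w + log(1 + e^{-w})`
    have hsplit : Real.log (1 + Real.exp ((wq : ℚ) : ℝ)) =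
        ((wq : ℚ) : ℝ) + Real.log (1 + Real.exp (-((wq : ℚ) : ℝ))) := by
      have hpos := Real.exp_pos ((wq : ℚ) : ℝ)
      have : 1 + Real.exp ((wq : ℚ) : ℝ) = Real.exp ((wq : ℚ) : ℝ) * (1 + Real.exp (-((wq : ℚ) : ℝ))) := by
        rw [mul_add, mul_one, ← Real.exp_add, add_neg_cancel, Real.exp_zero]; ring
      rw [this, Real.log_mul hpos.ne' (by positivity), Real.log_exp]
    rw [hsplit]
    have hneg1 : Real.exp (-((wq : ℚ) : ℝ)) ≤ 1 := Real.exp_le_one_iff.2 (by linarith)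
    have hneg0 := (Real.exp_pos (-((wq : ℚ) : ℝ))).le
    by_cases hd : 0 < rdn (rdn (emu.1 * e.elo) * f.elo)
    · rw [if_pos hd]
      have hdR : (0 : ℝ) < ((rdn (rdn (emu.1 * e.elo) * f.elo) : ℚ) : ℝ) := by exact_mod_cast hd
      have hdle : (((rdn (rdn (emu.1 * e.elo) * f.elo)) : ℚ) : ℝ) ≤ Real.exp ((wq : ℚ) : ℝ) := by
        apply rdn_cast_le; push_cast
        rw [hw, hfac]
        have h1 : ((rdn (emu.1 * e.elo) : ℚ) : ℝ) ≤ Real.exp ((β : ℝ) * μ) * Real.exp (-2 * (β : ℝ) * uR N e.idx) := by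
          apply rdn_cast_le; push_cast
          exact mul_le_mul hmu1 he1 he0.le (Real.exp_pos _).le
        by_cases hr : 0 ≤ ((rdn (emu.1 * e.elo) : ℚ) : ℝ)
        · exact mul_le_mul h1 hf1 hf0.le (hr.trans h1)
        · have : ((rdn (emu.1 * e.elo) : ℚ) : ℝ) * f.elo ≤ 0 :=
            mul_nonpos_of_nonpos_of_nonneg (lt_of_not_ge hr).le hf0.le
          exact this.trans (by positivity)
      have hE : Real.exp (-((wq : ℚ) : ℝ)) ≤ ((rup (1 / rdn (rdn (emu.1 * e.elo) * f.elo)) : ℚ) : ℝ) := by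
        apply cast_le_rup; push_cast
        rw [Real.exp_neg, ← one_div]
        exact one_div_le_one_div_of_le hdR hdle
      have h := log_one_add_le_log1pUpper hneg0 hneg1 hE
      linarith
    · rw [if_neg hd]
      have h2 : Real.log (1 + Real.exp (-((wq : ℚ) : ℝ))) ≤ Real.log 2 :=
        Real.log_le_log (by positivity) (by linarith)
      linarith [log_two_le_log2Hi]

/-! ### §3 The checker and the soundness theorem -/

/-- Generic list sum used by the checker (structural recursion, kernel-friendly). [folklore] -/
def sumOver (L : List Entry) (f : Entry → ℚ) : ℚ :=
  match L with
  | [] => 0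
  | e :: t => f e + sumOver t f

/-- `sumOver` is the indexed sum over `getD`. [folklore] -/
private theorem sumOver_eq (L : List Entry) (f : Entry → ℚ) (d : Entry) :
    sumOver L f = ∑ i ∈ Finset.range L.length, f (L.getD i d) := by
  induction L with
  | nil => simp [sumOver]
  | cons x t ih =>
    rw [sumOver, ih, List.length_cons, Finset.sum_range_succ']
    simp only [List.getD_cons_succ, List.getD_cons_zero]
    ring

/-- Row sum `Σ_f Ω⁺_f · G(e,f)`. [folklore] -/
def rowSum (β μ : ℚ) (N : ℕ) (emu : ℚ × ℚ) (L : List Entry) (e : Entry) : ℚ :=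
  sumOver L fun f => f.om * gBound β μ N emu e f

/-- Total `Σ_e Ω⁺_e · rup(rowSum e)`. [folklore] -/
def totalSum (β μ : ℚ) (N : ℕ) (emu : ℚ × ℚ) (L : List Entry) : ℚ :=
  sumOver L fun e => e.om * rup (rowSum β μ N emu L e)

/-- Per-entry checks (index-consistent `Ω⁺`, exp enclosure reproduced by `expEncl`, positivity). [folklore] -/
def entryOK (β : ℚ) (N : ℕ) (e : Entry) : Bool :=
  decide (omegaPlus N e.idx ≤ e.om) && decide (0 ≤ e.om) &&
    decide (0 < (expPos |(-2) * β * nodeU N e.idx|).1) &&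
    decide (e.elo ≤ (expEncl ((-2) * β * nodeU N e.idx)).1) &&
    decide ((expEncl ((-2) * β * nodeU N e.idx)).2 ≤ e.ehi) && decide (0 < e.elo)

/-- The table is indexed `0, 1, …` and every entry passes `entryOK`. [folklore] -/
def entriesOK (β : ℚ) (N : ℕ) : ℕ → List Entry → Bool
  | _, [] => true
  | i, e :: t => decide (e.idx = i) && entryOK β N e && entriesOK β N (i + 1) t

/-- **The certificate checker** for `freeGCPressure β μ ≤ P` (`N ≥ 1`, table of `2N+1` entries, `emu` an enclosure of `e^{βμ}`).
[cite: DavisRabinowitz1984, Sect. 2.1] -/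
def check (β μ : ℚ) (N : ℕ) (emu : ℚ × ℚ) (L : List Entry) (P : ℚ) : Bool :=
  decide (1 ≤ N) && decide (L.length = 2 * N + 1) && entriesOK β N 0 L &&
    decide (|β * μ| ≤ 32) && decide (|2 * β| ≤ 32) && decide (0 ≤ P) &&
    decide (0 < (expPos |β * μ|).1) && decide (0 < emu.1) &&
    decide (emu.1 ≤ (expEncl (β * μ)).1) && decide ((expEncl (β * μ)).2 ≤ emu.2) &&
    decide (totalSum β μ N emu L ≤ 4 * piLo * piLo * P)

/-- Unpacking `entriesOK`. [folklore] -/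
private theorem entriesOK_get {β : ℚ} {N : ℕ} (d : Entry) :
    ∀ (L : List Entry) (i : ℕ), entriesOK β N i L = true →
      ∀ k < L.length, (L.getD k d).idx = i + k ∧ entryOK β N (L.getD k d) = true := by
  intro L
  induction L with
  | nil => intro i _ k hk; simp at hk
  | cons e t ih =>
    intro i h k hk
    simp only [entriesOK, Bool.and_eq_true, decide_eq_true_eq] at h
    obtain ⟨⟨h1, h2⟩, h3⟩ := h
    cases k with
    | zero => simpa using ⟨h1, h2⟩
    | succ k =>
      have hk' : k < t.length := by simpa using hk
      have := ih (i + 1) h3 k hk'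
      simp only [List.getD_cons_succ]
      exact ⟨by rw [this.1]; ring, this.2⟩

/-- **Soundness of the checker**: `check β μ N emu L P = true → freeGCPressure β μ ≤ P`.
[cite: DavisRabinowitz1984, Sect. 2.1] [cite: AshcroftMermin1976, Ch. 2 eq. (2.49)] -/
theorem freeGCPressure_le_of_check (β μ : ℚ) (N : ℕ) (emu : ℚ × ℚ) (L : List Entry) (P : ℚ)
    (h : check β μ N emu L P = true) : freeGCPressure (β : ℝ) (μ : ℝ) ≤ ((P : ℚ) : ℝ) := by
  simp only [check, Bool.and_eq_true, decide_eq_true_eq] at h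
  obtain ⟨⟨⟨⟨⟨⟨⟨⟨⟨⟨hN, hlen⟩, hent⟩, hbμ⟩, hb2⟩, hP0⟩, hposμ⟩, hemu0⟩, hemu1⟩, hemu2⟩, htot⟩ := h
  set M := 2 * N with hM
  have hM1 : 1 ≤ M := by omega
  let d : Entry := ⟨0, 0, 0, 0⟩
  have hget := entriesOK_get d L 0 hent
  -- entry data as index functions
  have hidx : ∀ p ≤ M, (L.getD p d).idx = p := fun p hp => by
    have := (hget p (by rw [hlen]; omega)).1; simpa using this
  have hE : ∀ p ≤ M, entryOK β N (L.getD p d) = true := fun p hp => (hget p (by rw [hlen]; omega)).2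
  -- exp enclosures
  have hemu : ExpOK ((β : ℝ) * μ) emu.1 emu.2 := by
    have h := expEncl_spec (β * μ) hbμ hposμ
    push_cast at h
    exact ⟨by exact_mod_cast hemu0, (by exact_mod_cast hemu1 : ((emu.1 : ℚ) : ℝ) ≤ ((expEncl (β * μ)).1 : ℝ)).trans h.1,
      h.2.trans (by exact_mod_cast hemu2)⟩
  have hEe : ∀ p ≤ M, ExpOK (-2 * (β : ℝ) * uR N (L.getD p d).idx) (L.getD p d).elo (L.getD p d).ehi ∧
      omegaPlus N p ≤ (L.getD p d).om ∧ 0 ≤ (L.getD p d).om := by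
    intro p hp
    have h := hE p hp
    simp only [entryOK, Bool.and_eq_true, decide_eq_true_eq] at h
    obtain ⟨⟨⟨⟨⟨h1, h2⟩, h3⟩, h4⟩, h5⟩, h6⟩ := h
    rw [hidx p hp] at h1 h3 h4 h5 ⊢
    have hy : |(-2) * β * nodeU N p| ≤ 32 := by
      rw [abs_mul]
      have hu : |nodeU N p| ≤ 1 := by
        have h01 := uR_zero_and_last hN
        have hmono : ∀ a b, a ≤ b → b ≤ M → uR N a ≤ uR N b := by
          intro a b hab hbM
          induction b, hab using Nat.le_induction with
          | base => exact le_rfl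
          | succ b hab ih => exact (ih (by omega)).trans (uR_lt_succ hN b (by omega)).le
        have hlo := hmono 0 p (Nat.zero_le _) hp
        have hhi := hmono p M hp le_rfl
        rw [h01.1] at hlo; rw [h01.2] at hhi
        unfold uR at hlo hhi
        rw [abs_le]
        exact ⟨by exact_mod_cast hlo, by exact_mod_cast hhi⟩
      calc |(-2) * β| * |nodeU N p| ≤ |(-2) * β| * 1 := mul_le_mul_of_nonneg_left hu (abs_nonneg _)
        _ = |2 * β| := by rw [mul_one, show (-2) * β = -(2 * β) by ring, abs_neg]
        _ ≤ 32 := hb2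
    have hsp := expEncl_spec ((-2) * β * nodeU N p) hy h3
    have hcast : ((((-2) * β * nodeU N p : ℚ)) : ℝ) = -2 * (β : ℝ) * uR N p := by unfold uR; push_cast; ring
    rw [hcast] at hsp
    exact ⟨⟨by exact_mod_cast h6, (by exact_mod_cast h4 : (((L.getD p d).elo : ℚ) : ℝ) ≤ _).trans hsp.1,
      hsp.2.trans (by exact_mod_cast h5)⟩, h1, h2⟩
  -- the analytic inequality
  obtain ⟨hg0, hgc, hga, hgb⟩ := gR_props β μ
  have h01 := uR_zero_and_last hN
  let G : ℕ → ℕ → ℝ := fun p q => ((gBound β μ N emu (L.getD p d) (L.getD q d) : ℚ) : ℝ)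
  have hG : ∀ p ≤ M, ∀ q ≤ M, gR β μ (uR N p) (uR N q) ≤ G p q := by
    intro p hp q hq
    have h := gR_le_gBound β μ N emu (L.getD p d) (L.getD q d) hemu (hEe p hp).1 (hEe q hq).1
    rwa [hidx p hp, hidx q hq] at h
  have hG0 : ∀ p ≤ M, ∀ q ≤ M, 0 ≤ G p q := fun p hp q hq => (hg0 _ _).trans (hG p hp q hq)
  have hquad := setIntegral_brillouin_two_le_sum_hat hM1 (fun p hp => uR_lt_succ hN p hp) h01.1 h01.2 hgc hg0 hga hgb hG
  -- the integrand is the free log-weight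
  have hfun : ∀ k : Fin 2 → ℝ, freeLogWeight (β : ℝ) (μ : ℝ) k = gR β μ (Real.cos (k 0)) (Real.cos (k 1)) := by
    intro k
    simp only [freeLogWeight, gR, Fin.sum_univ_two]
    congr 3
    ring
  have hI : ∫ k in brillouin 2, freeLogWeight (β : ℝ) (μ : ℝ) k = ∫ k in brillouin 2, gR β μ (Real.cos (k 0)) (Real.cos (k 1)) :=
    setIntegral_congr_fun (measurableSet_brillouin 2) fun k _ => hfun k
  -- bounding the double sum by the checker's total
  set om : ℕ → ℝ := fun p => (((L.getD p d).om : ℚ) : ℝ) with hom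
  have hΩ : ∀ p ≤ M, omegaR N p ≤ om p ∧ 0 ≤ om p := fun p hp => by
    simp only [hom]
    exact ⟨(omegaR_le_omegaPlus hN p hp).trans (by exact_mod_cast (hEe p hp).2.1), by exact_mod_cast (hEe p hp).2.2⟩
  have hsum1 : ∑ p ∈ Finset.range (M + 1), ∑ q ∈ Finset.range (M + 1), G p q * omegaR N p * omegaR N q ≤
      ∑ p ∈ Finset.range (M + 1), om p * ∑ q ∈ Finset.range (M + 1), om q * G p q := by
    refine Finset.sum_le_sum fun p hp => ?_
    have hpM : p ≤ M := Nat.lt_succ_iff.1 (Finset.mem_range.1 hp)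
    rw [Finset.mul_sum]
    refine Finset.sum_le_sum fun q hq => ?_
    have hqM : q ≤ M := Nat.lt_succ_iff.1 (Finset.mem_range.1 hq)
    have h1 : G p q * omegaR N p * omegaR N q ≤ G p q * om p * omegaR N q :=
      mul_le_mul_of_nonneg_right (mul_le_mul_of_nonneg_left (hΩ p hpM).1 (hG0 p hpM q hqM)) (omegaR_nonneg q)
    have h2 : G p q * om p * omegaR N q ≤ G p q * om p * om q :=
      mul_le_mul_of_nonneg_left (hΩ q hqM).1 (mul_nonneg (hG0 p hpM q hqM) (hΩ p hpM).2)
    linarith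
  have hrow : ∀ p ≤ M, ∑ q ∈ Finset.range (M + 1), om q * G p q =
      ((rowSum β μ N emu L (L.getD p d) : ℚ) : ℝ) := by
    intro p _
    rw [rowSum, sumOver_eq L _ d, hlen]
    push_cast
    rfl
  have hsum2 : ∑ p ∈ Finset.range (M + 1), om p * ∑ q ∈ Finset.range (M + 1), om q * G p q ≤
      ((totalSum β μ N emu L : ℚ) : ℝ) := by
    rw [totalSum, sumOver_eq L _ d, hlen]
    push_cast
    refine Finset.sum_le_sum fun p hp => ?_
    have hpM : p ≤ M := Nat.lt_succ_iff.1 (Finset.mem_range.1 hp)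
    rw [hrow p hpM]
    exact mul_le_mul_of_nonneg_left (by exact_mod_cast le_rup _) (hΩ p hpM).2
  have htotR : ((totalSum β μ N emu L : ℚ) : ℝ) ≤ 4 * piLo * piLo * P := by exact_mod_cast htot
  -- assemble
  have hπ := Real.pi_gt_d20
  have hpiLo : ((piLo : ℚ) : ℝ) ≤ π := by push_cast [piLo]; linarith
  have hpiLo0 : (0 : ℝ) ≤ piLo := by push_cast [piLo]; norm_num
  have hP0R : (0 : ℝ) ≤ P := by exact_mod_cast hP0
  have hI_le : ∫ k in brillouin 2, freeLogWeight (β : ℝ) (μ : ℝ) k ≤ 4 * π * π * P := by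
    rw [hI]
    refine (hquad.trans (hsum1.trans (hsum2.trans (htotR.trans ?_))))
    have := mul_le_mul hpiLo hpiLo hpiLo0 Real.pi_pos.le
    nlinarith
  unfold freeGCPressure
  have h4 : (0 : ℝ) < (2 * π) ^ 2 := by positivity
  rw [inv_mul_le_iff₀ h4]
  nlinarith [hI_le, Real.pi_pos]

end FreeGCQuadrature

end Literature.MathematicalPhysics.QuantumLattice

end
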